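import Literature.MathematicalPhysics.QuantumFieldTheory.Balaban1983to89.T4ShellMeasureFibre

/-!
# `T4Continuum.ShellMeasureWindowRestrict` — owner audit (γ3) «(LR)_j AT THE BLOCK»: the window binder of the
# live-level END is inhabited by RESTRICTION TO THE SUB-THRESHOLD EVENT + the reach reading (kernel bookkeeping)
(cell `pub-balaban`, sub-cell `t4`, spine estimate NE7c (node U5b); owner lineage `b2b-balaban-t4-ne7c-p1` gen 32,
owner table `t4/b2b-balaban-t4-ne7c-p1/LEAVES-NE7c-P1.md` row **S87**; ADDITIVE — imports the tree leaf
`T4ShellMeasureFibre` (p187010; hence `T4ShellMeasure`) ONLY, cited BY NAME; [folklore]; 0 `def`, 0 `def … : Prop`,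
0 sorry, 0 citation tags)

HONEST FRAMING.  Finite four-torus programme, rung (B)+1 only — NOT infinite volume, NOT a mass gap, NOT the Clay
problem, NOT summit progress; (B), `BetaPertHyp`, (B^μ) not consumed.  NE7c (`T4IndicatorShell.ShellWeightBound`) is NOT
PRINTED in [Balaban 1983–89] and NOT PROVED; «NE7c ⇐ the named binders» (trigger c3).  Nothing printed is asserted
here; no estimate of Bałaban's is discharged; this file is measure-theoretic BOOKKEEPING (restriction of a measure to a
superset of the shell event) and says precisely which ONE located reading the window binder then rests on.

THE AUDIT THIS FILE SERVES (owner NOTE N-ne7cp1-g32-2; WALL-NE7c-P1 v2.3 §2b rows `S`∕`hSr`∕`hFsupp`∕`W`, §6 «open owner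
audit γ3»).  The live-level ENDs (S70 f4 ∕ S76 f1–f2 ∕ S80 `…_assembled`) display the WINDOW binder
`hFsupp : F (fixTo T U₀ (V[Λ := y])) ≠ 0 → every block bond of y lies within 2 sin(S∕2) of the centre` together with
`W ⊆ B̄_S`, `hJW`.  At a live slot the realized law `(fieldMeasure P j SU2).withDensity F` has the slot's OWN small-field
indicator SUMMED OUT ((R), `T4IndicatorShell.sum_shell`), so NO factor of `F` forces the block variables into a window.
But (M1) only weighs the SHELL `{θ(1−ρ) ≤ u < θ}` against the total mass, and the shell lies inside the sub-threshold
event `{u < θ}`: (M1) for the law RESTRICTED to `{u < θ}` implies (M1) for the law itself with the SAME constant (§1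
`slotAntiConcentration_of_restrict(_lt)`: `T4ShellMeasureFibre.slotAntiConcentration_of_dominated` with `M = 1`), and
restricting a `withDensity` law to `{u < θ}` is the same as multiplying the density by the indicator (§2
`slotAntiConcentration_withDensity_of_indicator`: Mathlib `withDensity_indicator` ∘ `restrict_withDensity`).  The
indicator-multiplied density `F′ := 𝟙{u < θ}·F` then satisfies the END's `hFsupp` as soon as ONE located reading holds
(§3 `support_of_indicator_mul`, hypothesis `hreach`): «`u(W) < θ_j` ⟹ every tree-gauged block bond of `W` lies within
`2 sin(S_j∕2)` of the centre» — which is [B14 (2.17): the tested variable is `sup_{p⊂□} |U_{j,□}(V)(∂p) − 1|` over the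
FINE plaquettes of the localized minimiser, whose block average IS `V` on `□` by (2.16)] the average-regularity step
«fine plaquettes `< ε_jη_j²` ⟹ unit plaquettes of `V` on `□^{∼4}` `< C(L)ε_j`» ([Balaban1985Averaging] Props 1∕2 TYPE;
for the explicit one-step average these are KERNEL in the tree, `B7Prop2Explicit`, F-ne7cL04g4-1) composed with the
KERNEL reach lemma S1 `ShellMeasureAxialReach.dist1_le_of_comb` on the box `□^{∼4}` of `n_j + 1` sites per direction
(`dist1 ≤ (d − 1)·n_j·C(L)ε_j`, so `S_j = (π∕2)(d−1)n_jC(L)ε_j ∝ R_jε_j` — WALL §2b row 2's `S ∼ c₀Mε_j`).  The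
remaining dictionary step (the restricted density's chart sections = `𝟙{u∘section < θ}·Jco·e^{−𝓔}`, with the extra
indicator CENTRE-MONOTONE by the core map (S-i) that the END itself derives from `hAN`∕`hSM`) is crew plumbing (row
S87 f2).  γ3 thus closes as: KERNEL (restriction, reach) + ONE located reading of printed TYPE (average regularity on
`□^{∼4}`) + [dict]; independent of and compatible with the window READING OF RECORD T-NE7c-8 (parameter reading on
fibres of the block average, W-d), which it does not replace.  NOTHING in the countdown moves; NE7c NOT PROVED; spine
PROVED 0∕9.  HONEST DEPENDENCY (cell): continuum YM on T⁴ ⇐ BetaPertH ∧ nine spine estimates (0/9 proved); BetaPertH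
⇐ (D1) ∧ (D4) ∧ CAP+tail; G-an2-4 gates asym, D1 and NE2/3/4.
-/

noncomputable section

open Set MeasureTheory

namespace Summit.QuantumFields.BalabanUV.T4Continuum.ShellMeasureWindowRestrict

open scoped ENNReal
open Literature.MathematicalPhysics.QuantumFieldTheory.Balaban1983to89
open T4ShellMeasure (SlotAntiConcentration)
open T4ShellMeasureFibre (slotAntiConcentration_of_dominated)

variable {Ω : Type*} [MeasurableSpace Ω]

/-! ## §1 (M1) from (M1) for the law restricted to a superset of the shell -/

/-- **(M1) FROM A RESTRICTION.**  If the shell `{θ(1−ρ) ≤ u < θ}` lies in `R` and the law RESTRICTED to `R` satisfies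
(M1) with constant `D`, then so does the law itself (the shell mass is unchanged, the total mass can only grow):
`T4ShellMeasureFibre.slotAntiConcentration_of_dominated` with `μ' := μ.restrict R`, `M := 1`. [folklore] -/
theorem slotAntiConcentration_of_restrict {μ : Measure Ω} {u : Ω → ℝ} {θ ρ D : ℝ} {R : Set Ω} (hD : 0 ≤ D)
    (hρ : 0 ≤ ρ) (hR : {x | θ * (1 - ρ) ≤ u x ∧ u x < θ} ⊆ R)
    (h : SlotAntiConcentration (μ.restrict R) u θ ρ D) : SlotAntiConcentration μ u θ ρ D := by
  have hS : μ {x | θ * (1 - ρ) ≤ u x ∧ u x < θ} ≤ μ.restrict R {x | θ * (1 - ρ) ≤ u x ∧ u x < θ} := by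
    have e : {x | θ * (1 - ρ) ≤ u x ∧ u x < θ} ∩ R = {x | θ * (1 - ρ) ≤ u x ∧ u x < θ} := inter_eq_left.2 hR
    calc μ {x | θ * (1 - ρ) ≤ u x ∧ u x < θ} = μ ({x | θ * (1 - ρ) ≤ u x ∧ u x < θ} ∩ R) := by rw [e]
      _ ≤ μ.restrict R {x | θ * (1 - ρ) ≤ u x ∧ u x < θ} := Measure.le_restrict_apply _ _
  have hmass : μ.restrict R univ ≤ ENNReal.ofReal 1 * μ univ := by
    rw [ENNReal.ofReal_one, one_mul, Measure.restrict_apply_univ]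
    exact measure_mono (subset_univ R)
  simpa using slotAntiConcentration_of_dominated hD hρ hS h hmass

/-- **(M1) FROM THE SUB-THRESHOLD RESTRICTION**: the case `R := {u < θ}` (which contains the shell trivially). [folklore] -/
theorem slotAntiConcentration_of_restrict_lt {μ : Measure Ω} {u : Ω → ℝ} {θ ρ D : ℝ} (hD : 0 ≤ D) (hρ : 0 ≤ ρ)
    (h : SlotAntiConcentration (μ.restrict {x | u x < θ}) u θ ρ D) : SlotAntiConcentration μ u θ ρ D :=
  slotAntiConcentration_of_restrict hD hρ (fun _ hx => hx.2) h

/-! ## §2 Restricting a `withDensity` law to `{u < θ}` = multiplying the density by the indicator -/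

/-- the sub-threshold event of a measurable tested variable is measurable. [folklore] -/
theorem measurableSet_lt_threshold {u : Ω → ℝ} (hu : Measurable u) (θ : ℝ) : MeasurableSet {x | u x < θ} :=
  hu measurableSet_Iio

/-- the indicator-multiplied density is measurable. [folklore] -/
theorem measurable_indicator_density {u : Ω → ℝ} (hu : Measurable u) (θ : ℝ) {F : Ω → ℝ≥0∞} (hF : Measurable F) :
    Measurable ({x | u x < θ}.indicator F) :=
  hF.indicator (measurableSet_lt_threshold hu θ)

/-- **(M1) FOR A `withDensity` LAW FROM (M1) FOR THE INDICATOR-MULTIPLIED DENSITY.**  For a measurable tested variable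
`u` and any density `F`: (M1) for `ν.withDensity (𝟙{u < θ}·F)` implies (M1) for `ν.withDensity F`, same constant —
`ν.withDensity (𝟙_R F) = (ν.restrict R).withDensity F = (ν.withDensity F).restrict R` (Mathlib `withDensity_indicator`,
`restrict_withDensity`) and §1.  This is the form the live-level ENDs consume: they conclude (M1) for
`(fieldMeasure P j SU2).withDensity F′`, and `F′ := 𝟙{u < θ}·F` carries the window support (§3). [folklore] -/
theorem slotAntiConcentration_withDensity_of_indicator {ν : Measure Ω} {F : Ω → ℝ≥0∞} {u : Ω → ℝ} {θ ρ D : ℝ}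
    (hu : Measurable u) (hD : 0 ≤ D) (hρ : 0 ≤ ρ)
    (h : SlotAntiConcentration (ν.withDensity ({x | u x < θ}.indicator F)) u θ ρ D) :
    SlotAntiConcentration (ν.withDensity F) u θ ρ D := by
  have hm := measurableSet_lt_threshold hu θ
  rw [withDensity_indicator hm, ← restrict_withDensity hm] at h
  exact slotAntiConcentration_of_restrict_lt hD hρ h

/-- … and conversely the restricted law inherits (M1)'s HYPOTHESIS SIDE for free: the two laws have the SAME shell mass
(so nothing is lost by restricting). [folklore] -/
theorem shell_restrict_eq {ν : Measure Ω} {F : Ω → ℝ≥0∞} {u : Ω → ℝ} (hu : Measurable u) (θ ρ : ℝ) :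
    (ν.withDensity ({x | u x < θ}.indicator F)) {x | θ * (1 - ρ) ≤ u x ∧ u x < θ} =
      (ν.withDensity F) {x | θ * (1 - ρ) ≤ u x ∧ u x < θ} := by
  have hm := measurableSet_lt_threshold hu θ
  have hsh : MeasurableSet {x | θ * (1 - ρ) ≤ u x ∧ u x < θ} :=
    (hu measurableSet_Ici).inter (hu measurableSet_Iio)
  rw [withDensity_indicator hm, ← restrict_withDensity hm, Measure.restrict_apply hsh]
  congr 1
  exact inter_eq_left.2 fun _ hx => hx.2

/-! ## §3 The indicator-multiplied density meets the END's window-support binder from ONE reach reading -/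

/-- **WINDOW SUPPORT FROM THE REACH READING.**  For any property `P` of configurations (in the ENDs: «every block
bond of the tree-gauged configuration lies within `2 sin(S∕2)` of the centre»): if `u W < θ → P W` (the located
reading: sub-threshold tested variable ⟹ block bonds in the window — average regularity on `□^{∼4}` ∘ S1 axial reach),
then `(𝟙{u < θ}·F) W ≠ 0 → P W` — the END's `hFsupp` for the density `F′`. [folklore] -/
theorem support_of_indicator_mul {X : Type*} {F : X → ℝ≥0∞} {u : X → ℝ} {θ : ℝ} {P : X → Prop}
    (hreach : ∀ W, u W < θ → P W) : ∀ W, ({x | u x < θ}.indicator F) W ≠ 0 → P W := by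
  intro W hW
  by_cases hx : W ∈ {x | u x < θ}
  · exact hreach W hx
  · exact absurd (indicator_of_notMem hx F) hW

/-- **INVARIANCE IS PRESERVED**: if `u` and `F` are invariant under a map `g` (in the ENDs: every gauge transformation —
`GaugeInvariant u`, `GaugeInvariant F`), so is `𝟙{u < θ}·F`. [folklore] -/
theorem indicator_mul_invariant {X : Type*} {F : X → ℝ≥0∞} {u : X → ℝ} {θ : ℝ} {g : X → X}
    (hu : ∀ W, u (g W) = u W) (hF : ∀ W, F (g W) = F W) (W : X) :
    ({x | u x < θ}.indicator F) (g W) = ({x | u x < θ}.indicator F) W := by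
  by_cases hW : u W < θ
  · have hgW : g W ∈ {x | u x < θ} := by simpa [mem_setOf_eq, hu W] using hW
    rw [indicator_of_mem hgW, indicator_of_mem (show W ∈ {x | u x < θ} from hW), hF W]
  · have hgW : g W ∉ {x | u x < θ} := by simpa [mem_setOf_eq, hu W] using hW
    rw [indicator_of_notMem hgW, indicator_of_notMem (show W ∉ {x | u x < θ} from hW)]

/-- **THE DICTIONARY SIDE** (what row S87 f2 wires): on a chart section `x ↦ sect x` the restricted density reads
`(𝟙{u < θ}·F)(sect x) = 𝟙{u(sect x) < θ}·F(sect x)` — the END's `hRdict` with the co-test factor `Jco`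
multiplied by the indicator of `{x | u(section x) < θ}` (centre-monotone by the core map (S-i)). [folklore] -/
theorem indicator_mul_section {X Y : Type*} {F : X → ℝ≥0∞} {u : X → ℝ} {θ : ℝ} (sect : Y → X) (x : Y) :
    ({W | u W < θ}.indicator F) (sect x) = {y | u (sect y) < θ}.indicator (F ∘ sect) x := by
  by_cases hx : u (sect x) < θ
  · rw [indicator_of_mem (show sect x ∈ {W | u W < θ} from hx), indicator_of_mem (show x ∈ {y | u (sect y) < θ} from hx),
      Function.comp_apply]
  · rw [indicator_of_notMem (show sect x ∉ {W | u W < θ} from hx),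
      indicator_of_notMem (show x ∉ {y | u (sect y) < θ} from hx)]

/-- NON-VACUITY (trigger c3): on `ℝ` with Lebesgue measure restricted nowhere special, the tested variable `u = id`,
`θ = 1`, `ρ = 0`, `D = 0`: the shell `{1 ≤ x < 1}` is empty, so (M1) holds for the restricted law and §1 returns it for
the law. [folklore] -/
example : SlotAntiConcentration (volume : Measure ℝ) id 1 0 0 := by
  refine slotAntiConcentration_of_restrict_lt le_rfl le_rfl ?_
  unfold SlotAntiConcentration
  have : {x : ℝ | 1 * (1 - 0) ≤ id x ∧ id x < 1} = ∅ := by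
    ext x; simp
  rw [this, measure_empty]
  exact bot_le

end Summit.QuantumFields.BalabanUV.T4Continuum.ShellMeasureWindowRestrict

end
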